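import Summits.AnomalousDissipation.AnomalousDissipation.Theorems.StirringSphereEnsembleRealizationStubAugEnergy
import Literature.Analysis.FluidPDE.CylindricalGenerator
import Literature.Analysis.FluidPDE.NSHopfGalerkinLimit

/-!
# Crux `EnsembleRealization` (stmt-AnomalousDissipation-0215) — line `augmented-lift`,
# sub-stub M2a `stub_augLimit`, tools part (v): from the frame modes at rational times to all
# Galerkin modes at all times

Supports stmt-AnomalousDissipation-0215 (sub-stub `stub_augLimit` of the reshaped stub
`stub_augmentedLaw`, line `augmented-lift`). Nothing here closes an item.

Deterministic bookkeeping along ONE path `ω ∈ 𝒦(R, L)` with `L²` field `v t` (`𝓕(v t) = ω̄(t)`):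
the modewise identities `(v t, e) − (v s, e) = ∫ₛᵗ flux_e(v τ) dτ` (i) pass from rational to real
times `0 ≤ s ≤ t` (`modeIdent_real_of_rat`: `t ↦ (v t, e)` is continuous on `[0, ∞)`, the flux
is bounded and measurable there as a limit of bounded continuous cylindrical approximants,
`fluxData_of_approx`); (ii) are linear over finite real combinations of modes
(`modeIdent_finset_sum_smul`); (iii) hold for constant modes when the zero coefficient of the path
vanishes and the force is mean free (`modeIdent_const`); hence (iv) hold for every Galerkin mode
`IsGalerkinMode M g` once they hold for the single real modes along transversal frames
(`Torus.fourierTruncate_eq_sum_frame`). Main statement: `stub_augLimitModesTools`.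
-/

noncomputable section

set_option linter.dupNamespace false

open MeasureTheory Set Filter Topology Function Metric UnitAddTorus
open scoped BigOperators ENNReal InnerProductSpace RealInnerProductSpace

namespace Summit.AnomalousDissipation.AnomalousDissipation.Theorems.EnsembleRealization

open Literature.Analysis.FunctionSpaces Literature.Analysis.FunctionSpaces.Torus
open Literature.Analysis.FluidPDE Literature.Analysis.FluidPDE.Torus
open Summit.AnomalousDissipation.AnomalousDissipation.Theorems.MomentParity

variable {ν : ℝ} {f : UnitAddTorus (Fin 3) → EuclideanSpace ℝ (Fin 3)} {R : ℝ} {L : (Fin 3 → ℤ) → ℝ}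
  {γ : Path (Fin 3)} {v : ℝ → UnitAddTorus (Fin 3) → EuclideanSpace ℝ (Fin 3)}

/-! ### The flux along a path field: boundedness and measurability from the approximants -/

/-- The flux integrand of an `L²` field against a smooth mode is integrable. -/
theorem integrable_fluxIntegrand (hf : MemLp f 2 volume) {e : UnitAddTorus (Fin 3) → EuclideanSpace ℝ (Fin 3)}
    (he : IsSmooth e) {w : UnitAddTorus (Fin 3) → EuclideanSpace ℝ (Fin 3)} (hw : MemLp w 2 volume) :
    Integrable (fun x => ⟪w x, convect w e x⟫_ℝ + ν * ⟪w x, laplacian e x⟫_ℝ + ⟪f x, e x⟫_ℝ) volume :=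
  ((integrable_inner_convect_self hw he).add
    ((integrable_inner_of_continuous (hw.integrable one_le_two) he.laplacian.continuous).const_mul ν)).add
    (integrable_inner_of_continuous (hf.integrable one_le_two) he.continuous)

/-- **The flux along a path field is bounded and measurable on `[0, ∞)`** when it is the limit of
bounded continuous cylindrical approximants `c_M(ω̄ τ)` (`|c_M| ≤ B`). -/
theorem fluxData_of_approx (hγ : γ ∈ pathSpace R L)
    (hcoef : ∀ t, 0 ≤ t → MemLp (v t) 2 volume ∧
      ∀ k, mFourierCoeff (EuclideanSpace.complexify ∘ v t) k = pathExt γ t k)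
    {e : UnitAddTorus (Fin 3) → EuclideanSpace ℝ (Fin 3)}
    {B : ℝ} {c : ℕ → ((Fin 3 → ℤ) → EuclideanSpace ℂ (Fin 3)) → ℝ} (hc : ∀ M, Continuous (c M))
    (hcB : ∀ M z, |c M z| ≤ B)
    (hcw : ∀ w : UnitAddTorus (Fin 3) → EuclideanSpace ℝ (Fin 3), MemLp w 2 volume → ∫ x, ‖w x‖ ^ 2 ≤ R ^ 2 →
      Tendsto (fun M => c M fun k => mFourierCoeff (EuclideanSpace.complexify ∘ w) k) atTop (𝓝 (∫ x, (⟪((w) : UnitAddTorus (Fin 3) → EuclideanSpace ℝ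
            (Fin 3)) x, convect (w) (e) x⟫_ℝ + ν * ⟪((w) : UnitAddTorus (Fin 3) → EuclideanSpace ℝ (Fin 3)) x, laplacian (e) x⟫_ℝ + ⟪f x, (e) x⟫_ℝ)))) :
    (∀ τ, 0 ≤ τ → |(∫ x, (⟪((v τ) : UnitAddTorus (Fin 3) → EuclideanSpace ℝ (Fin 3)) x, convect (v τ) (e) x⟫_ℝ + ν * ⟪((v τ) : UnitAddTorus (Fin 3) →
          EuclideanSpace ℝ (Fin 3)) x, laplacian (e) x⟫_ℝ + ⟪f x, (e) x⟫_ℝ))| ≤ B) ∧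
      AEStronglyMeasurable (fun τ => (∫ x, (⟪((v τ) : UnitAddTorus (Fin 3) → EuclideanSpace ℝ (Fin 3)) x, convect (v τ) (e) x⟫_ℝ + ν * ⟪((v τ) :
            UnitAddTorus (Fin 3) → EuclideanSpace ℝ (Fin 3)) x, laplacian (e) x⟫_ℝ + ⟪f x, (e) x⟫_ℝ))) (volume.restrict (Ici 0)) := by
  have hlim : ∀ τ, 0 ≤ τ → Tendsto (fun M => c M fun k => pathExt γ τ k) atTop (𝓝 (∫ x, (⟪((v τ) : UnitAddTorus (Fin 3) → EuclideanSpace ℝ (Fin 3))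
        x, convect (v τ) (e) x⟫_ℝ + ν * ⟪((v τ) : UnitAddTorus (Fin 3) → EuclideanSpace ℝ (Fin 3)) x, laplacian (e) x⟫_ℝ + ⟪f x, (e) x⟫_ℝ))) := by
    intro τ hτ
    have hce : (fun k => pathExt γ τ k) = fun k => mFourierCoeff (EuclideanSpace.complexify ∘ v τ) k :=
      funext fun k => ((hcoef τ hτ).2 k).symm
    rw [hce]
    refine hcw (v τ) (hcoef τ hτ).1 ?_
    rw [integral_norm_sq_eq_pathEnergyTot (hcoef τ hτ).1 (hcoef τ hτ).2]
    exact pathEnergyTot_le hγ τ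
  refine ⟨fun τ hτ => ?_, ?_⟩
  · have h := (hlim τ hτ).abs
    exact le_of_tendsto' (b := B) h fun M => hcB M fun k => pathExt γ τ k
  refine aestronglyMeasurable_of_tendsto_ae (atTop : Filter ℕ)
    (f := fun M (τ : ℝ) => c M fun k => pathExt γ τ k) (fun M => ?_) ?_
  · exact ((hc M).comp ((continuous_pi fun k => continuous_pathExt_subtype_prod R L k).comp
      (Continuous.prodMk_right (⟨γ, hγ⟩ : ↥(pathSpace R L))))).aestronglyMeasurable
  · filter_upwards [ae_restrict_mem measurableSet_Ici] with τ hτ using hlim τ hτ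

/-- A bounded function measurable on `[0, ∞)` is interval integrable between nonnegative times. -/
theorem intervalIntegrable_of_fluxData {φ : ℝ → ℝ} {B : ℝ} (hb : ∀ τ, 0 ≤ τ → |φ τ| ≤ B)
    (hm : AEStronglyMeasurable φ (volume.restrict (Ici 0))) {a b : ℝ} (ha : 0 ≤ a) (hb0 : 0 ≤ b) :
    IntervalIntegrable φ volume a b := by
  have hsub : Set.uIoc a b ⊆ Ici 0 := fun τ hτ => by
    rcases mem_uIoc.1 hτ with h | h
    exacts [ha.trans h.1.le, hb0.trans h.1.le]
  rw [intervalIntegrable_iff]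
  have hfin : volume (Set.uIoc a b) < ∞ := by rw [Real.volume_uIoc]; exact ENNReal.ofReal_lt_top
  refine IntegrableOn.of_bound hfin (hm.mono_measure (Measure.restrict_mono hsub le_rfl)) B ?_
  filter_upwards [ae_restrict_mem measurableSet_uIoc] with τ hτ
  rw [Real.norm_eq_abs]
  exact hb τ (hsub hτ)

/-! ### From rational to real times -/

/-- **The modewise identity passes from rational to real times.** Along `γ ∈ 𝒦(R, L)` with `L²`
field `v`, if the flux against the `L²` mode `e` is bounded and measurable on `[0, ∞)` and the
identity holds between all rationals `0 ≤ q ≤ q'`, it holds between all reals `0 ≤ s ≤ t`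
(`t ↦ (v t, e)` is continuous on `[0, ∞)`, `continuousOn_integral_inner_pathField`). -/
theorem modeIdent_real_of_rat (hγ : γ ∈ pathSpace R L)
    (hcoef : ∀ t, 0 ≤ t → MemLp (v t) 2 volume ∧
      ∀ k, mFourierCoeff (EuclideanSpace.complexify ∘ v t) k = pathExt γ t k)
    {e : UnitAddTorus (Fin 3) → EuclideanSpace ℝ (Fin 3)} (he : MemLp e 2 volume)
    {B : ℝ} (hb : ∀ τ, 0 ≤ τ → |(∫ x, (⟪((v τ) : UnitAddTorus (Fin 3) → EuclideanSpace ℝ (Fin 3)) x, convect (v τ) (e) x⟫_ℝ + ν * ⟪((v τ) :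
          UnitAddTorus (Fin 3) → EuclideanSpace ℝ (Fin 3)) x, laplacian (e) x⟫_ℝ + ⟪f x, (e) x⟫_ℝ))| ≤ B)
    (hm : AEStronglyMeasurable (fun τ => (∫ x, (⟪((v τ) : UnitAddTorus (Fin 3) → EuclideanSpace ℝ (Fin 3)) x, convect (v τ) (e) x⟫_ℝ + ν * ⟪((v τ) :
          UnitAddTorus (Fin 3) → EuclideanSpace ℝ (Fin 3)) x, laplacian (e) x⟫_ℝ + ⟪f x, (e) x⟫_ℝ))) (volume.restrict (Ici 0)))
    (hrat : ∀ q q' : ℚ, 0 ≤ q → q ≤ q' → (((∫ x, ⟪v ((q' : ℝ)) x, (e) x⟫_ℝ) - ∫ x, ⟪v ((q : ℝ)) x, (e) x⟫_ℝ = ∫ τ in ((q : ℝ))..((q' : ℝ)), (∫ x,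
          (⟪((v τ) : UnitAddTorus (Fin 3) → EuclideanSpace ℝ (Fin 3)) x, convect (v τ) (e) x⟫_ℝ + ν * ⟪((v τ) : UnitAddTorus (Fin 3) → EuclideanSpace
          ℝ (Fin 3)) x, laplacian (e) x⟫_ℝ + ⟪f x, (e) x⟫_ℝ))))) {s t : ℝ} (hs : 0 ≤ s) (hst : s ≤ t) :
    (((∫ x, ⟪v (t) x, (e) x⟫_ℝ) - ∫ x, ⟪v (s) x, (e) x⟫_ℝ = ∫ τ in (s)..(t), (∫ x, (⟪((v τ) : UnitAddTorus (Fin 3) → EuclideanSpace ℝ (Fin 3)) x,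
          convect (v τ) (e) x⟫_ℝ + ν * ⟪((v τ) : UnitAddTorus (Fin 3) → EuclideanSpace ℝ (Fin 3)) x, laplacian (e) x⟫_ℝ + ⟪f x, (e) x⟫_ℝ)))) := by
  have hv0 : ∀ t, 0 ≤ t → MemLp (v t) 2 volume ∧
      ∀ k, mFourierCoeff (EuclideanSpace.complexify ∘ v t) k = pathExt γ (0 + t) k := fun t ht =>
    ⟨(hcoef t ht).1, fun k => by rw [zero_add]; exact (hcoef t ht).2 k⟩
  have hΦ : ContinuousOn (fun t : ℝ => ∫ x, ⟪v t x, e x⟫_ℝ) (Ici 0) := continuousOn_integral_inner_pathField hγ hv0 he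
  have hI : ∀ a b : ℝ, 0 ≤ a → 0 ≤ b → IntervalIntegrable (fun τ => (∫ x, (⟪((v τ) : UnitAddTorus (Fin 3) → EuclideanSpace ℝ (Fin 3)) x, convect (v
        τ) (e) x⟫_ℝ + ν * ⟪((v τ) : UnitAddTorus (Fin 3) → EuclideanSpace ℝ (Fin 3)) x, laplacian (e) x⟫_ℝ + ⟪f x, (e) x⟫_ℝ))) volume a b :=
    fun a b ha hb0 => intervalIntegrable_of_fluxData hb hm ha hb0
  -- the identity from time `0` to every real time `t ≥ 0`
  have h0 : ∀ t : ℝ, 0 ≤ t → (∫ x, ⟪v t x, e x⟫_ℝ) - (∫ x, ⟪v 0 x, e x⟫_ℝ) = ∫ τ in (0 : ℝ)..t, (∫ x, (⟪((v τ) : UnitAddTorus (Fin 3) →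
        EuclideanSpace ℝ (Fin 3)) x, convect (v τ) (e) x⟫_ℝ + ν * ⟪((v τ) : UnitAddTorus (Fin 3) → EuclideanSpace ℝ (Fin 3)) x, laplacian (e) x⟫_ℝ +
        ⟪f x, (e) x⟫_ℝ)) := by
    intro t ht
    have hq0 : ∀ n : ℕ, (0 : ℝ) ≤ dyadicFloor t n := fun n => by exact_mod_cast dyadicFloor_nonneg t n
    have hqt : Tendsto (fun n : ℕ => (dyadicFloor t n : ℝ)) atTop (𝓝 t) := by
      simpa only [max_eq_left ht] using tendsto_dyadicFloor t
    have hn : ∀ n : ℕ, (∫ x, ⟪v (dyadicFloor t n) x, e x⟫_ℝ) - (∫ x, ⟪v 0 x, e x⟫_ℝ) =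
        ∫ τ in (0 : ℝ)..(dyadicFloor t n), (∫ x, (⟪((v τ) : UnitAddTorus (Fin 3) → EuclideanSpace ℝ (Fin 3)) x, convect (v τ) (e) x⟫_ℝ + ν * ⟪((v τ)
              : UnitAddTorus (Fin 3) → EuclideanSpace ℝ (Fin 3)) x, laplacian (e) x⟫_ℝ + ⟪f x, (e) x⟫_ℝ)) := fun n => by
      have h := hrat 0 (dyadicFloor t n) le_rfl (dyadicFloor_nonneg t n)
      rwa [Rat.cast_zero] at h
    have hl : Tendsto (fun n : ℕ => (∫ x, ⟪v (dyadicFloor t n) x, e x⟫_ℝ) - ∫ x, ⟪v 0 x, e x⟫_ℝ) atTop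
        (𝓝 ((∫ x, ⟪v t x, e x⟫_ℝ) - ∫ x, ⟪v 0 x, e x⟫_ℝ)) :=
      ((hΦ t ht).tendsto.comp (tendsto_nhdsWithin_iff.2 ⟨hqt, Eventually.of_forall hq0⟩)).sub tendsto_const_nhds
    have hr : Tendsto (fun n : ℕ => ∫ τ in (0 : ℝ)..(dyadicFloor t n), (∫ x, (⟪((v τ) : UnitAddTorus (Fin 3) → EuclideanSpace ℝ (Fin 3)) x, convect
          (v τ) (e) x⟫_ℝ + ν * ⟪((v τ) : UnitAddTorus (Fin 3) → EuclideanSpace ℝ (Fin 3)) x, laplacian (e) x⟫_ℝ + ⟪f x, (e) x⟫_ℝ))) atTop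
        (𝓝 (∫ τ in (0 : ℝ)..t, (∫ x, (⟪((v τ) : UnitAddTorus (Fin 3) → EuclideanSpace ℝ (Fin 3)) x, convect (v τ) (e) x⟫_ℝ + ν * ⟪((v τ) :
              UnitAddTorus (Fin 3) → EuclideanSpace ℝ (Fin 3)) x, laplacian (e) x⟫_ℝ + ⟪f x, (e) x⟫_ℝ)))) :=
      tendsto_intervalIntegral_of_bound hI hb le_rfl ht (fun _ => le_rfl) hq0 tendsto_const_nhds hqt
    exact tendsto_nhds_unique (hl.congr hn) hr
  have h1 := h0 t (hs.trans hst)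
  have h2 := h0 s hs
  rw [← intervalIntegral.integral_interval_sub_left (hI 0 t le_rfl (hs.trans hst)) (hI 0 s le_rfl hs)]
  linarith

/-! ### Linearity over finite real combinations of modes -/

/-- **The modewise identities are linear in the mode**: if they hold (between `s ≤ t`, `0 ≤ s`)
for smooth modes `e i`, `i ∈ I`, whose fluxes are interval integrable on `[s, t]`, they hold for
`∑_{i ∈ I} λ_i • e i`. -/
theorem modeIdent_finset_sum_smul (hf : MemLp f 2 volume)
    (hcoef : ∀ t, 0 ≤ t → MemLp (v t) 2 volume ∧
      ∀ k, mFourierCoeff (EuclideanSpace.complexify ∘ v t) k = pathExt γ t k)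
    {ι : Type*} (I : Finset ι) (lam : ι → ℝ) {e : ι → UnitAddTorus (Fin 3) → EuclideanSpace ℝ (Fin 3)}
    (he : ∀ i, IsSmooth (e i)) {s t : ℝ} (hs : 0 ≤ s) (hst : s ≤ t)
    (hI : ∀ i ∈ I, IntervalIntegrable (fun τ => (∫ x, (⟪((v τ) : UnitAddTorus (Fin 3) → EuclideanSpace ℝ (Fin 3)) x, convect (v τ) (e i) x⟫_ℝ + ν *
          ⟪((v τ) : UnitAddTorus (Fin 3) → EuclideanSpace ℝ (Fin 3)) x, laplacian (e i) x⟫_ℝ + ⟪f x, (e i) x⟫_ℝ))) volume s t)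
    (hid : ∀ i ∈ I, (((∫ x, ⟪v (t) x, (e i) x⟫_ℝ) - ∫ x, ⟪v (s) x, (e i) x⟫_ℝ = ∫ τ in (s)..(t), (∫ x, (⟪((v τ) : UnitAddTorus (Fin 3) →
          EuclideanSpace ℝ (Fin 3)) x, convect (v τ) (e i) x⟫_ℝ + ν * ⟪((v τ) : UnitAddTorus (Fin 3) → EuclideanSpace ℝ (Fin 3)) x, laplacian (e i)
          x⟫_ℝ + ⟪f x, (e i) x⟫_ℝ))))) :
    (((∫ x, ⟪v (t) x, (fun y => ∑ i ∈ I, lam i • e i y) x⟫_ℝ) - ∫ x, ⟪v (s) x, (fun y => ∑ i ∈ I, lam i • e i y) x⟫_ℝ = ∫ τ in (s)..(t), (∫ x, (⟪((v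
          τ) : UnitAddTorus (Fin 3) → EuclideanSpace ℝ (Fin 3)) x, convect (v τ) (fun y => ∑ i ∈ I, lam i • e i y) x⟫_ℝ + ν * ⟪((v τ) : UnitAddTorus
          (Fin 3) → EuclideanSpace ℝ (Fin 3)) x, laplacian (fun y => ∑ i ∈ I, lam i • e i y) x⟫_ℝ + ⟪f x, (fun y => ∑ i ∈ I, lam i • e i y) x⟫_ℝ)))) := by
  -- pairings of a sum of modes
  have hP : ∀ τ, 0 ≤ τ → ∫ x, ⟪v τ x, ∑ i ∈ I, lam i • e i x⟫_ℝ = ∑ i ∈ I, lam i * ∫ x, ⟪v τ x, e i x⟫_ℝ := by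
    intro τ hτ
    simp_rw [inner_sum, inner_smul_right]
    rw [integral_finsetSum I fun i _ =>
      (integrable_inner_of_continuous ((hcoef τ hτ).1.integrable one_le_two) (he i).continuous).const_mul _]
    exact Finset.sum_congr rfl fun i _ => integral_const_mul _ _
  -- fluxes of a sum of modes
  have hF : ∀ τ, 0 ≤ τ → (∫ x, (⟪((v τ) : UnitAddTorus (Fin 3) → EuclideanSpace ℝ (Fin 3)) x, convect (v τ) (fun y => ∑ i ∈ I, lam i • e i y) x⟫_ℝ +
        ν * ⟪((v τ) : UnitAddTorus (Fin 3) → EuclideanSpace ℝ (Fin 3)) x, laplacian (fun y => ∑ i ∈ I, lam i • e i y) x⟫_ℝ + ⟪f x, (fun y => ∑ i ∈ I,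
        lam i • e i y) x⟫_ℝ)) = ∑ i ∈ I, lam i * (∫ x, (⟪((v τ) : UnitAddTorus (Fin 3) → EuclideanSpace ℝ (Fin 3)) x, convect (v τ) (e i) x⟫_ℝ + ν *
        ⟪((v τ) : UnitAddTorus (Fin 3) → EuclideanSpace ℝ (Fin 3)) x, laplacian (e i) x⟫_ℝ + ⟪f x, (e i) x⟫_ℝ)) := by
    intro τ hτ
    have hw := (hcoef τ hτ).1
    have hstep : ∀ i ∈ I, lam i * (∫ x, (⟪((v τ) : UnitAddTorus (Fin 3) → EuclideanSpace ℝ (Fin 3)) x, convect (v τ) (e i) x⟫_ℝ + ν * ⟪((v τ) :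
          UnitAddTorus (Fin 3) → EuclideanSpace ℝ (Fin 3)) x, laplacian (e i) x⟫_ℝ + ⟪f x, (e i) x⟫_ℝ)) = ∫ x, lam i * (⟪v τ x, convect (v τ) (e i) x⟫_ℝ +
        ν * ⟪v τ x, laplacian (e i) x⟫_ℝ + ⟪f x, e i x⟫_ℝ) := fun i _ => (integral_const_mul _ _).symm
    rw [Finset.sum_congr rfl hstep, ← integral_finsetSum I fun i _ => (integrable_fluxIntegrand hf (he i) hw).const_mul _]
    refine integral_congr_ae (ae_of_all _ fun x => ?_)
    dsimp only
    rw [Torus.convect_finset_sum_smul I lam he, Torus.laplacian_finset_sum_smul I lam he]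
    simp only [inner_sum, inner_smul_right, Finset.mul_sum, ← Finset.sum_add_distrib]
    exact Finset.sum_congr rfl fun i _ => by ring
  rw [hP t (hs.trans hst), hP s hs, intervalIntegral.integral_congr (g := fun τ => ∑ i ∈ I, lam i * (∫ x, (⟪((v τ) : UnitAddTorus (Fin 3) →
        EuclideanSpace ℝ (Fin 3)) x, convect (v τ) (e i) x⟫_ℝ + ν * ⟪((v τ) : UnitAddTorus (Fin 3) → EuclideanSpace ℝ (Fin 3)) x, laplacian (e i)
        x⟫_ℝ + ⟪f x, (e i) x⟫_ℝ)))
    fun τ hτ => hF τ (hs.trans (by rw [uIcc_of_le hst] at hτ; exact hτ.1)),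
    intervalIntegral.integral_finsetSum fun i hi => (hI i hi).const_mul _, ← Finset.sum_sub_distrib]
  refine Finset.sum_congr rfl fun i hi => ?_
  rw [intervalIntegral.integral_const_mul, ← hid i hi]
  ring

/-! ### Constant modes -/

/-- The convective derivative of a constant mode vanishes. -/
theorem convect_fun_const (w : UnitAddTorus (Fin 3) → EuclideanSpace ℝ (Fin 3)) (z : EuclideanSpace ℝ (Fin 3))
    (x : UnitAddTorus (Fin 3)) : convect w (fun _ : UnitAddTorus (Fin 3) => z) x = 0 := by
  -- adapted from `convect_const` (Onsager1949Proofs)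
  have h : liftAt (fun _ : UnitAddTorus (Fin 3) => z) x = fun _ => z := rfl
  simp [Literature.Analysis.FunctionSpaces.Torus.convect, Literature.Analysis.FunctionSpaces.Torus.fderiv, h]

/-- **The modewise identity for constant modes**: both sides vanish when the zero coefficient of
the path vanishes (`(v t, z) = Re⟪ω̄(t, 0), z⟫ = 0`) and the force is mean free (the Laplacian and
the convective derivative of a constant vanish); the flux is then interval integrable. -/
theorem modeIdent_const (hf : MemLp f 2 volume) (hf0 : HasZeroMean f)
    (hcoef : ∀ t, 0 ≤ t → MemLp (v t) 2 volume ∧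
      ∀ k, mFourierCoeff (EuclideanSpace.complexify ∘ v t) k = pathExt γ t k)
    (hz : ∀ t, 0 ≤ t → pathExt γ t 0 = 0) (z : EuclideanSpace ℝ (Fin 3)) {s t : ℝ} (hs : 0 ≤ s) (hst : s ≤ t) :
    IntervalIntegrable (fun τ => (∫ x, (⟪((v τ) : UnitAddTorus (Fin 3) → EuclideanSpace ℝ (Fin 3)) x, convect (v τ) (fun _ => z) x⟫_ℝ + ν * ⟪((v τ) :
          UnitAddTorus (Fin 3) → EuclideanSpace ℝ (Fin 3)) x, laplacian (fun _ => z) x⟫_ℝ + ⟪f x, (fun _ => z) x⟫_ℝ))) volume s t ∧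
    ((∫ x, ⟪v t x, (fun _ => z) x⟫_ℝ) - ∫ x, ⟪v s x, (fun _ => z) x⟫_ℝ = ∫ τ in s..t, (∫ x, (⟪((v τ) : UnitAddTorus (Fin 3) → EuclideanSpace ℝ (Fin
          3)) x, convect (v τ) (fun _ => z) x⟫_ℝ + ν * ⟪((v τ) : UnitAddTorus (Fin 3) → EuclideanSpace ℝ (Fin 3)) x, laplacian (fun _ => z) x⟫_ℝ + ⟪f
          x, (fun _ => z) x⟫_ℝ))) := by
  -- the Laplacian of a constant mode vanishes (adapted from `laplacian_fun_const`, DoeringFoiasPowerProofs)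
  have hΔ : ∀ x, laplacian (fun _ : UnitAddTorus (Fin 3) => z) x = 0 := fun x => by
    have h : liftAt (fun _ : UnitAddTorus (Fin 3) => z) x = fun _ => z := rfl
    simp only [Literature.Analysis.FunctionSpaces.Torus.laplacian, h]
    rw [InnerProductSpace.laplacian_const]
    rfl
  -- the pairings vanish
  have hP : ∀ τ, 0 ≤ τ → ∫ x, ⟪v τ x, z⟫_ℝ = 0 := by
    intro τ hτ
    have hi : Integrable (v τ) volume := (hcoef τ hτ).1.integrable one_le_two
    rw [integral_congr_ae (ae_of_all _ fun x => real_inner_comm z (v τ x)), integral_inner hi z]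
    have h0 : mFourierCoeff (EuclideanSpace.complexify ∘ v τ) 0 = 0 := by rw [(hcoef τ hτ).2 0, hz τ hτ]
    rw [mFourierCoeff_eq_integral_volume] at h0
    simp only [neg_zero, mFourier_zero, ContinuousMap.one_apply, one_smul, Function.comp_apply] at h0
    have hint : ∫ x, EuclideanSpace.complexify (v τ x) = EuclideanSpace.complexify (∫ x, v τ x) :=
      EuclideanSpace.complexify.integral_comp_comm (v τ)
    have h0' : EuclideanSpace.complexify (ι := Fin 3) (∫ x, v τ x) = 0 := by rw [← hint]; exact h0
    have h1 : ∫ x, v τ x = 0 :=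
      (EuclideanSpace.complexify (ι := Fin 3)).injective (h0'.trans (map_zero _).symm)
    rw [h1, inner_zero_right]
  -- the fluxes vanish
  have hF : ∀ τ, (∫ x, (⟪((v τ) : UnitAddTorus (Fin 3) → EuclideanSpace ℝ (Fin 3)) x, convect (v τ) (fun _ => z) x⟫_ℝ + ν * ⟪((v τ) : UnitAddTorus
        (Fin 3) → EuclideanSpace ℝ (Fin 3)) x, laplacian (fun _ => z) x⟫_ℝ + ⟪f x, (fun _ => z) x⟫_ℝ)) = 0 := by
    intro τ
    simp only [convect_fun_const, hΔ, inner_zero_right, mul_zero, zero_add]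
    rw [integral_congr_ae (ae_of_all _ fun x => real_inner_comm z (f x)), integral_inner (hf.integrable one_le_two) z]
    have h0 : ∫ x, f x = 0 := hf0
    rw [h0, inner_zero_right]
  have hF' : (fun τ => (∫ x, (⟪((v τ) : UnitAddTorus (Fin 3) → EuclideanSpace ℝ (Fin 3)) x, convect (v τ) (fun _ => z) x⟫_ℝ + ν * ⟪((v τ) :
        UnitAddTorus (Fin 3) → EuclideanSpace ℝ (Fin 3)) x, laplacian (fun _ => z) x⟫_ℝ + ⟪f x, (fun _ => z) x⟫_ℝ))) = fun _ => (0 : ℝ) := funext hF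
  refine ⟨by rw [hF']; exact intervalIntegrable_const, ?_⟩
  rw [hP t (hs.trans hst), hP s hs]
  simp only [hF, intervalIntegral.integral_zero, sub_self]

/-! ### The tools stub: all Galerkin modes -/

/-- **Tools stub (to be registered as `stub_augLimitModesTools`): the modewise identities for
all Galerkin modes at all times.** Along `γ ∈ 𝒦(R, L)` with `L²` field `v t` (`𝓕(v t) = ω̄(t)`,
`t ≥ 0`) whose zero coefficient vanishes, with `f ∈ L²` mean free and a transversal frame `fr k`
at every frequency, suppose that for every single real mode `e = Re(z e_k)`, `z = fr k l`,
`k ≠ 0`, the flux is a limit of bounded continuous cylindrical approximants along fields of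
energy `≤ R²` and the modewise identity holds between rational times. Then the identity holds
for every Galerkin mode `IsGalerkinMode M g` and all real `0 ≤ s ≤ t`. -/
theorem stub_augLimitModesTools (hf : MemLp f 2 volume) (hf0 : HasZeroMean f) {R : ℝ} {L : (Fin 3 → ℤ) → ℝ}
    {γ : Path (Fin 3)} (hγ : γ ∈ pathSpace R L) {v : ℝ → UnitAddTorus (Fin 3) → EuclideanSpace ℝ (Fin 3)}
    (hcoef : ∀ t, 0 ≤ t → MemLp (v t) 2 volume ∧
      ∀ k, mFourierCoeff (EuclideanSpace.complexify ∘ v t) k = pathExt γ t k)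
    (hz : ∀ t, 0 ≤ t → pathExt γ t 0 = 0)
    (fr : (Fin 3 → ℤ) → Fin 3 × Bool → EuclideanSpace ℂ (Fin 3))
    (hfr : ∀ k (z : EuclideanSpace ℂ (Fin 3)), ∑ j, (k j : ℂ) * z j = 0 →
      z = ∑ l : Fin 3 × Bool, (if l.2 then (z l.1).im else (z l.1).re) • fr k l)
    (happrox : ∀ k : Fin 3 → ℤ, k ≠ 0 → ∀ l : Fin 3 × Bool,
      ∃ (B : ℝ) (c : ℕ → ((Fin 3 → ℤ) → EuclideanSpace ℂ (Fin 3)) → ℝ),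
        (∀ M, Continuous (c M)) ∧ (∀ M z, |c M z| ≤ B) ∧
        (∀ w : UnitAddTorus (Fin 3) → EuclideanSpace ℝ (Fin 3), MemLp w 2 volume → ∫ x, ‖w x‖ ^ 2 ≤ R ^ 2 →
          Tendsto (fun M => c M fun k' => mFourierCoeff (EuclideanSpace.complexify ∘ w) k') atTop
            (𝓝 (∫ x, (⟪w x, convect w (realTrigPoly {k} fun _ => fr k l) x⟫_ℝ +
              ν * ⟪w x, laplacian (realTrigPoly {k} fun _ => fr k l) x⟫_ℝ +
              ⟪f x, realTrigPoly {k} (fun _ => fr k l) x⟫_ℝ)))))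
    (hrat : ∀ k : Fin 3 → ℤ, k ≠ 0 → ∀ (l : Fin 3 × Bool) (q q' : ℚ), 0 ≤ q → q ≤ q' →
      (∫ x, ⟪v q' x, realTrigPoly {k} (fun _ => fr k l) x⟫_ℝ) - (∫ x, ⟪v q x, realTrigPoly {k} (fun _ => fr k l) x⟫_ℝ) =
        ∫ τ in (q : ℝ)..q', ∫ x, (⟪v τ x, convect (v τ) (realTrigPoly {k} fun _ => fr k l) x⟫_ℝ +
          ν * ⟪v τ x, laplacian (realTrigPoly {k} fun _ => fr k l) x⟫_ℝ +
          ⟪f x, realTrigPoly {k} (fun _ => fr k l) x⟫_ℝ))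
    (M : ℕ) (g : UnitAddTorus (Fin 3) → EuclideanSpace ℝ (Fin 3)) (hg : IsGalerkinMode M g)
    {s t : ℝ} (hs : 0 ≤ s) (hst : s ≤ t) :
    (∫ x, ⟪v t x, g x⟫_ℝ) - (∫ x, ⟪v s x, g x⟫_ℝ) =
      ∫ τ in s..t, ∫ x, (⟪v τ x, convect (v τ) g x⟫_ℝ + ν * ⟪v τ x, laplacian g x⟫_ℝ + ⟪f x, g x⟫_ℝ) := by
  classical
  -- the frame expansion of the Galerkin mode
  set I : Finset ((Fin 3 → ℤ) × (Fin 3 × Bool)) := freqBall M ×ˢ Finset.univ with hI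
  set e : (Fin 3 → ℤ) × (Fin 3 × Bool) → UnitAddTorus (Fin 3) → EuclideanSpace ℝ (Fin 3) :=
    fun i => realTrigPoly {i.1} (fun _ => fr i.1 i.2) with he
  set lam : (Fin 3 → ℤ) × (Fin 3 × Bool) → ℝ := fun i =>
    if i.2.2 then (mFourierCoeff (EuclideanSpace.complexify ∘ g) i.1 i.2.1).im
      else (mFourierCoeff (EuclideanSpace.complexify ∘ g) i.1 i.2.1).re with hlam
  have he_smooth : ∀ i, IsSmooth (e i) := fun i => isSmooth_realTrigPoly _ _
  have hgsum : g = fun y => ∑ i ∈ I, lam i • e i y := by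
    funext y
    rw [← fourierTruncate_eq_self hg.isSmooth.continuous hg.2.2,
      Torus.fourierTruncate_eq_sum_frame hfr (fun k => hg.isDivFree.sum_mul_mFourierCoeff_eq_zero hg.isSmooth k)]
  -- the identity for each frame mode
  have hmode : ∀ i ∈ I, IntervalIntegrable (fun τ => (∫ x, (⟪v τ x, convect (v τ) (e i) x⟫_ℝ + ν * ⟪v τ x, laplacian (e i) x⟫_ℝ + ⟪f x, (e i) x⟫_ℝ)))
        volume s t ∧
      ((∫ x, ⟪v t x, e i x⟫_ℝ) - ∫ x, ⟪v s x, e i x⟫_ℝ = ∫ τ in s..t, (∫ x, (⟪v τ x, convect (v τ) (e i) x⟫_ℝ + ν * ⟪v τ x, laplacian (e i) x⟫_ℝ + ⟪f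
            x, (e i) x⟫_ℝ))) := by
    intro i _
    by_cases hk : i.1 = 0
    · -- constant mode
      have hconst : e i = fun _ => EuclideanSpace.realPart (fr i.1 i.2) := by
        funext y
        simp only [he, realTrigPoly_singleton_apply, hk, mFourier_zero, ContinuousMap.one_apply, one_smul]
      rw [hconst]
      exact modeIdent_const hf hf0 hcoef hz _ hs hst
    · obtain ⟨B, c, hc, hcB, hcw⟩ := happrox i.1 hk i.2
      obtain ⟨hb, hm⟩ := fluxData_of_approx (ν := ν) (f := f) hγ hcoef hc hcB hcw
      exact ⟨intervalIntegrable_of_fluxData hb hm hs (hs.trans hst),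
        modeIdent_real_of_rat hγ hcoef ((he_smooth i).memLp 2) hb hm (hrat i.1 hk i.2) hs hst⟩
  rw [hgsum]
  exact modeIdent_finset_sum_smul hf hcoef I lam he_smooth hs hst (fun i hi => (hmode i hi).1)
    fun i hi => (hmode i hi).2

end Summit.AnomalousDissipation.AnomalousDissipation.Theorems.EnsembleRealization
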